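import Literature.AlgebraicGeometry.Motives.MixedHodgeExtensionDualNonSeparated
import Literature.AlgebraicGeometry.Motives.MixedHodgeExtensionTateNonSeparated
import HarnessLib

/-!
# Extensions BY the Tate structures: `Ext(A, ℚ(m)) ≃ J⁰_W(A^∨(m))` for every mixed Hodge structure `A`

Jannsen, *Mixed Motives and Algebraic K-Theory* (LNM 1400), §9 LEMMA 9.2: for every mixed Hodge
structure `H`, `Ext¹_MH(ℤ, H) = W₀H_ℂ/(W₀H + F⁰W₀H_ℂ)`; in the tree (rationally, twisted):
`Ext(ℚ(-p), B) ≃ J⁰_W(B(p)) = W_{2p}B_ℂ/((F^p ∩ W_{2p})B_ℂ + W_{2p}B_ℚ)` (`Ext.tateEquivJacobianW`,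
extensions with `ℚ(-p)` as QUOTIENT). Carlson, *Extensions of mixed Hodge structures* (1980), §2(c)
Remark (3): passing to "the dual extension `0 → B̂ → Ĥ → Â → 0`" exchanges sub and quotient; in the
tree, for ARBITRARY pairs, `Ext.dualEquivW : Ext(A, B) ≃ Ext(B^∨, A^∨)`
(`MixedHodgeExtensionDualNonSeparated`).

This file combines the two into the classification of extensions with a Tate structure as SUB:
for every finite-dimensional mixed `ℚ`-Hodge structure `A` and every `m ∈ ℤ`,

  **`Ext(A, ℚ(m)) ≃ Ext(ℚ(m)^∨, A^∨) ≃ Ext(ℚ(-m), A^∨) ≃ J⁰_W(A^∨(m))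
      = W_{2m}(A^∨)_ℂ/((F^m ∩ W_{2m})A^∨_ℂ + W_{2m}A^∨_ℚ)`,   `W_{2m}(A^∨) = (W_{-2m-1}A)^⊥`**

(`Ext.tateSubEquivJacobianW`), through the isomorphism of mixed Hodge structures `ℚ(-m) ≅ ℚ(m)^∨`,
`q ↦ (x ↦ qx)` (`tateDualHom`, `tateDualHom_bijective`) and transport of `Ext` along isomorphisms
(`Ext.pullbackEquivW`, `Ext.pushoutEquivW`). Consequences: the invariant is additive for the Baer sum,
complete (`nonempty_congruence_iff_tateSubInvariant_eq`, `isSplit_iff_tateSubInvariant_eq_zero`) and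
surjective (`exists_tateSubInvariant_eq`); and **every extension `0 → ℚ(m) → E → A → 0` with `A` of
weights `< -2m` (the weight of `ℚ(m)`) splits** (`isSplit_of_W_eq_top`: then `W_{2m}(A^∨) = 0`).
Example: `A = H¹(X)` (weight `1`), `m = 0`: `Ext(H¹(X), ℚ(0)) ≃ J⁰(H¹(X)^∨)_ℚ = H₁(X)_ℂ/(F⁰ + H₁(X)_ℚ)`,
the rational Albanese — the extensions `0 → ℚ(0) → H¹(X rel D)⁰ → H¹(X) → 0` of relative cohomology.

## Main definitions and results (all proved; no named facts)

* `Ext.pullbackEquivW f hf : Ext A B ≃ Ext A' B` and `Ext.pushoutEquivW g hg : Ext A B ≃ Ext A B'`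
  for bijective morphisms (`_apply`, `_symm_apply`, `_addW`, `_zeroW`).
* `tateDualHom m : ℚ(-m) → ℚ(m)^∨`, `tateDualHom_toLinearMap_apply`, `tateDualHom_bijective`.
* **`Ext.tateSubEquivJacobianW A m : Ext A ℚ(m) ≃ J⁰_W(A^∨(m))`**, `tateSubEquivJacobianW_mkOfW`
  (`= e_W(f^*E^∨)`), `_addW`, `_zeroW`; `Extension.tateSubInvariant E`,
  `nonempty_congruence_iff_tateSubInvariant_eq`, `isSplit_iff_tateSubInvariant_eq_zero`,
  `tateSubInvariant_baerSum`, `exists_tateSubInvariant_eq`; `dual_W_two_mul_eq_bot`,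
  **`Extension.isSplit_of_W_eq_top`**.

## References

* [Jannsen1990MixedMotives] U. Jannsen, Mixed Motives and Algebraic K-Theory, LNM 1400 (1990), §9
  Lemma 9.2 (galaxy `panama:518548581515341`, pp. 89–90).
* [Carlson1980] J. A. Carlson, Extensions of mixed Hodge structures (1980), §2(c) Remark (3)
  (held text `book:beauvillend-proceedings-indo-french-conference-geometry`, PDF p. 91), §2(b) Prop. 1.
* [DeligneHodgeII1971] P. Deligne, Théorie de Hodge II, 1.1.7, 2.1.13.
* [MacLane1963Homology] S. Mac Lane, Homology (1963), Ch. III §1 (1.2), (1.4').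
* [CattaniElZeinGriffithsLe2014] E. Cattani et al. (eds.), Hodge Theory (2014), Thm. 3.2.18.
-/

open scoped TensorProduct

noncomputable section

namespace Literature.AlgebraicGeometry.Motives

namespace MixedHodgeStructure

open HodgeStructure (ofRat ofRat_apply tate dualBaseChange)

universe u u' v v' w

variable {VA : Type u} [AddCommGroup VA] [Module ℚ VA]
variable {VA' : Type u'} [AddCommGroup VA'] [Module ℚ VA']
variable {VB : Type v} [AddCommGroup VB] [Module ℚ VB]
variable {VB' : Type v'} [AddCommGroup VB'] [Module ℚ VB']
variable {VE : Type w} [AddCommGroup VE] [Module ℚ VE]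

/-! ### §1 Transport of `Ext` along isomorphisms -/

namespace Ext

variable {A : MixedHodgeStructure VA} {A' : MixedHodgeStructure VA'}
variable {B : MixedHodgeStructure VB} {B' : MixedHodgeStructure VB'}

omit [AddCommGroup VB'] [Module ℚ VB'] in
/-- **Pull-back along an isomorphism `f : A' ≅ A` is a bijection `Ext(A, B) ≃ Ext(A', B)`** with
inverse the pull-back along `f⁻¹` (`(f ∘ f⁻¹)^* = id`, `(f⁻¹ ∘ f)^* = id`; the inverse of a bijective
morphism is a morphism, Thm. 3.2.18). [cite: MacLane1963Homology, Ch. III §1 (1.2)] -/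
def pullbackEquivW (f : Hom A' A) (hf : Function.Bijective f.toLinearMap) : Ext A B ≃ Ext A' B where
  toFun := pullbackMapW f
  invFun := pullbackMapW (f.inverse hf)
  left_inv x := by rw [← pullbackMapW_comp, Hom.comp_inverse, pullbackMapW_id]
  right_inv x := by rw [← pullbackMapW_comp, Hom.inverse_comp, pullbackMapW_id]

omit [AddCommGroup VB'] [Module ℚ VB'] in
/-- `pullbackEquivW f = f^*` (by `rfl`). [cite: MacLane1963Homology, Ch. III §1 (1.2)] -/
@[simp]
theorem pullbackEquivW_apply (f : Hom A' A) (hf : Function.Bijective f.toLinearMap) (x : Ext A B) :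
    pullbackEquivW f hf x = pullbackMapW f x := rfl

omit [AddCommGroup VB'] [Module ℚ VB'] in
/-- `(pullbackEquivW f)⁻¹ = (f⁻¹)^*` (by `rfl`). [cite: MacLane1963Homology, Ch. III §1 (1.2)] -/
@[simp]
theorem pullbackEquivW_symm_apply (f : Hom A' A) (hf : Function.Bijective f.toLinearMap)
    (x : Ext A' B) : (pullbackEquivW (B := B) f hf).symm x = pullbackMapW (f.inverse hf) x := rfl

omit [AddCommGroup VB'] [Module ℚ VB'] in
/-- Transport along an isomorphism is additive for the Baer sum. [cite: MacLane1963Homology, Ch. III §1 (1.2)] -/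
theorem pullbackEquivW_addW (f : Hom A' A) (hf : Function.Bijective f.toLinearMap) (x y : Ext A B) :
    pullbackEquivW f hf (addW x y) = addW (pullbackEquivW f hf x) (pullbackEquivW f hf y) :=
  pullbackMapW_addW f x y

omit [AddCommGroup VB'] [Module ℚ VB'] in
/-- Transport along an isomorphism preserves the split class. [cite: MacLane1963Homology, Ch. III §1 (1.2)] -/
theorem pullbackEquivW_zeroW (f : Hom A' A) (hf : Function.Bijective f.toLinearMap) :
    pullbackEquivW (B := B) f hf zeroW = zeroW :=
  pullbackMapW_zeroW f

omit [AddCommGroup VA'] [Module ℚ VA'] in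
/-- **Push-out along an isomorphism `g : B ≅ B'` is a bijection `Ext(A, B) ≃ Ext(A, B')`** with
inverse the push-out along `g⁻¹`. [cite: MacLane1963Homology, Ch. III §1 (1.4')] -/
def pushoutEquivW (g : Hom B B') (hg : Function.Bijective g.toLinearMap) : Ext A B ≃ Ext A B' where
  toFun := pushoutMapW g
  invFun := pushoutMapW (g.inverse hg)
  left_inv x := by rw [← pushoutMapW_comp, Hom.inverse_comp, pushoutMapW_id]
  right_inv x := by rw [← pushoutMapW_comp, Hom.comp_inverse, pushoutMapW_id]

omit [AddCommGroup VA'] [Module ℚ VA'] in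
/-- `pushoutEquivW g = g_*` (by `rfl`). [cite: MacLane1963Homology, Ch. III §1 (1.4')] -/
@[simp]
theorem pushoutEquivW_apply (g : Hom B B') (hg : Function.Bijective g.toLinearMap) (x : Ext A B) :
    pushoutEquivW g hg x = pushoutMapW g x := rfl

omit [AddCommGroup VA'] [Module ℚ VA'] in
/-- `(pushoutEquivW g)⁻¹ = (g⁻¹)_*` (by `rfl`). [cite: MacLane1963Homology, Ch. III §1 (1.4')] -/
@[simp]
theorem pushoutEquivW_symm_apply (g : Hom B B') (hg : Function.Bijective g.toLinearMap)
    (x : Ext A B') : (pushoutEquivW (A := A) g hg).symm x = pushoutMapW (g.inverse hg) x := rfl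

omit [AddCommGroup VA'] [Module ℚ VA'] in
/-- Transport along an isomorphism of the sub is additive. [cite: MacLane1963Homology, Ch. III §1 (1.4')] -/
theorem pushoutEquivW_addW (g : Hom B B') (hg : Function.Bijective g.toLinearMap) (x y : Ext A B) :
    pushoutEquivW g hg (addW x y) = addW (pushoutEquivW g hg x) (pushoutEquivW g hg y) :=
  pushoutMapW_addW g x y

omit [AddCommGroup VA'] [Module ℚ VA'] in
/-- Transport along an isomorphism of the sub preserves the split class. [cite: MacLane1963Homology, Ch. III §1 (1.4')] -/
theorem pushoutEquivW_zeroW (g : Hom B B') (hg : Function.Bijective g.toLinearMap) :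
    pushoutEquivW (A := A) g hg zeroW = zeroW :=
  pushoutMapW_zeroW g

end Ext

/-! ### §2 The isomorphism `ℚ(-m) ≅ ℚ(m)^∨` -/

section TateDual

/-- **`ℚ(-m) → ℚ(m)^∨`, `q ↦ (x ↦ q x)`, is a morphism of mixed Hodge structures**: both sides have
the single weight `2m` (`W_r(ℚ(m)^∨) = (W_{-r-1}ℚ(m))^⊥`), and `F^q = everything` exactly for `q ≤ m`
on both sides (`F^q(ℚ(m)^∨) = (F^{1-q}ℚ(m))^⊥`). [cite: DeligneHodgeII1971, 1.1.7 and 2.1.13] -/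
def tateDualHom (m : ℤ) :
    Hom (tate (-m)).toMixedHodgeStructure (tate m).toMixedHodgeStructure.dual where
  toLinearMap := LinearMap.toSpanSingleton ℚ (Module.Dual ℚ ℚ) LinearMap.id
  map_W_le k := by
    by_cases hk : k < 2 * m
    · rw [tate_toMixedHodgeStructure_W_of_lt hk, Submodule.map_bot]
      exact bot_le
    · rw [dual_W, HodgeStructure.toMixedHodgeStructure_W (tate m), dualAnnihilator_trivialWeightFiltration,
        HodgeStructure.trivialWeightFiltration_of_le (show -(-2 * m) ≤ k by omega)]
      exact le_top
  map_F_le q := by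
    by_cases hq : q ≤ m
    · rw [dual_F, HodgeStructure.toMixedHodgeStructure_F (tate m), HodgeStructure.tate_F m,
        HodgeStructure.pureFiltration_of_lt (show -m < 1 - q by omega), Submodule.dualAnnihilator_bot,
        Submodule.comap_top]
      exact le_top
    · rw [tate_toMixedHodgeStructure_F_of_lt (not_le.1 hq), Submodule.map_bot]
      exact bot_le

/-- `tateDualHom m q = (x ↦ q x)`. [cite: DeligneHodgeII1971, 2.1.13] -/
@[simp]
theorem tateDualHom_toLinearMap_apply (m : ℤ) (q x : ℚ) : (tateDualHom m).toLinearMap q x = q * x := rfl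

/-- **`ℚ(-m) ≅ ℚ(m)^∨`**: the morphism `tateDualHom m` is bijective (`φ = φ(1) · id` on `ℚ`).
[cite: DeligneHodgeII1971, 2.1.13] -/
theorem tateDualHom_bijective (m : ℤ) : Function.Bijective (tateDualHom m).toLinearMap := by
  constructor
  · intro q q' h
    have h1 := LinearMap.congr_fun h 1
    rwa [tateDualHom_toLinearMap_apply, tateDualHom_toLinearMap_apply, mul_one, mul_one] at h1
  · intro φ
    refine ⟨φ 1, LinearMap.ext_ring ?_⟩
    rw [tateDualHom_toLinearMap_apply, mul_one]

end TateDual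

/-! ### §3 `Ext(A, ℚ(m)) ≃ J⁰_W(A^∨(m))` -/

section TateSub

variable [FiniteDimensional ℚ VA] (A : MixedHodgeStructure VA) (m : ℤ)

/-- **`Ext(A, ℚ(m)) ≃ J⁰_W(A^∨(m)) = W_{2m}(A^∨)_ℂ/((F^m ∩ W_{2m})A^∨_ℂ + W_{2m}A^∨_ℚ)` for EVERY
finite-dimensional mixed `ℚ`-Hodge structure `A`**: duality `Ext(A, ℚ(m)) ≃ Ext(ℚ(m)^∨, A^∨)`
(Carlson, Remark (3), all pairs), transport along `ℚ(-m) ≅ ℚ(m)^∨`, and Jannsen's Lemma 9.2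
`Ext(ℚ(-m), A^∨) ≃ J⁰_W(A^∨(m))`. [cite: Jannsen1990MixedMotives, §9 Lemma 9.2]
[cite: Carlson1980, §2(c) Remark (3)] -/
def Ext.tateSubEquivJacobianW :
    Ext A (tate m).toMixedHodgeStructure ≃ (A.dual.tateTwist m).jacobianW :=
  Ext.dualEquivW.trans <|
    (Ext.pullbackEquivW (tateDualHom m) (tateDualHom_bijective m)).trans
      (Ext.tateEquivJacobianW A.dual m)

/-- Unfolding: `tateSubEquivJacobianW x = tateEquivJacobianW A^∨ m (f^* x^∨)` with `f : ℚ(-m) ≅ ℚ(m)^∨`.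
[cite: Jannsen1990MixedMotives, §9 Lemma 9.2] -/
theorem Ext.tateSubEquivJacobianW_apply (x : Ext A (tate m).toMixedHodgeStructure) :
    Ext.tateSubEquivJacobianW A m x =
      Ext.tateEquivJacobianW A.dual m (Ext.pullbackMapW (tateDualHom m) (Ext.dualEquivW x)) := rfl

variable {A m} in
/-- **On the class of an extension `E : 0 → ℚ(m) → E → A → 0` (any finite-dimensional carrier) the
invariant is `e_W(f^* E^∨) ∈ J⁰_W(A^∨(m))`**, the Jannsen invariant of the pull-back along
`ℚ(-m) ≅ ℚ(m)^∨` of the dual extension `0 → A^∨ → E^∨ → ℚ(m)^∨ → 0`.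
[cite: Jannsen1990MixedMotives, §9 Lemma 9.2] [cite: Carlson1980, §2(c) Remark (3)] -/
theorem Ext.tateSubEquivJacobianW_mkOfW [FiniteDimensional ℚ VE]
    (E : Extension A (tate m).toMixedHodgeStructure VE) :
    Ext.tateSubEquivJacobianW A m (Ext.mkOfW E) =
      ((E.dual).pullback (tateDualHom m)).evalClassW := by
  rw [Ext.tateSubEquivJacobianW_apply, Ext.dualEquivW_mkOfW, Ext.pullbackMapW_mkOfW,
    Ext.tateEquivJacobianW_mkOfW]

/-- **Additivity**: the Baer sum goes to the sum in `J⁰_W(A^∨(m))`. [cite: Carlson1980, §2(b) Prop. 1] -/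
theorem Ext.tateSubEquivJacobianW_addW (x y : Ext A (tate m).toMixedHodgeStructure) :
    Ext.tateSubEquivJacobianW A m (Ext.addW x y) =
      Ext.tateSubEquivJacobianW A m x + Ext.tateSubEquivJacobianW A m y := by
  rw [Ext.tateSubEquivJacobianW_apply, Ext.tateSubEquivJacobianW_apply, Ext.tateSubEquivJacobianW_apply,
    Ext.dualEquivW_addW, Ext.pullbackMapW_addW, Ext.tateEquivJacobianW_addW]

/-- The split class goes to `0`. [cite: Carlson1980, §2(b) Prop. 1] -/
theorem Ext.tateSubEquivJacobianW_zeroW :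
    Ext.tateSubEquivJacobianW A m (Ext.zeroW : Ext A (tate m).toMixedHodgeStructure) = 0 := by
  rw [Ext.tateSubEquivJacobianW_apply, Ext.dualEquivW_zeroW, Ext.pullbackMapW_zeroW,
    Ext.tateEquivJacobianW_zeroW]

/-- The opposite class goes to the negative. [cite: Carlson1980, §2(b) Prop. 1] -/
theorem Ext.tateSubEquivJacobianW_negW (x : Ext A (tate m).toMixedHodgeStructure) :
    Ext.tateSubEquivJacobianW A m (Ext.negW x) = -Ext.tateSubEquivJacobianW A m x := by
  have h : Ext.tateSubEquivJacobianW A m (Ext.addW (Ext.negW x) x) = 0 := by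
    rw [Ext.negW_addW_cancel, Ext.tateSubEquivJacobianW_zeroW]
  rw [Ext.tateSubEquivJacobianW_addW] at h
  exact eq_neg_of_add_eq_zero_left h

namespace Extension

variable {A m}
variable (E : Extension A (tate m).toMixedHodgeStructure VE)

/-- **The invariant `e^∨_W(E) ∈ J⁰_W(A^∨(m))` of an extension `0 → ℚ(m) → E → A → 0`** (any
carrier): the image of its class `[E] ∈ Ext(A, ℚ(m))` under `Ext.tateSubEquivJacobianW`.
[cite: Jannsen1990MixedMotives, §9 Lemma 9.2] [cite: Carlson1980, §2(c) Remark (3)] -/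
def tateSubInvariant : (A.dual.tateTwist m).jacobianW :=
  Ext.tateSubEquivJacobianW A m (Ext.mkOfW E)

/-- `tateSubInvariant E = e_W(f^* E^∨)` (finite-dimensional carrier, so that `E^∨` is defined).
[cite: Jannsen1990MixedMotives, §9 Lemma 9.2] -/
theorem tateSubInvariant_eq_evalClassW [FiniteDimensional ℚ VE] :
    E.tateSubInvariant = ((E.dual).pullback (tateDualHom m)).evalClassW :=
  Ext.tateSubEquivJacobianW_mkOfW E

/-- **Completeness: two extensions of `A` by `ℚ(m)` (any finite-dimensional carriers) are congruent
iff their invariants in `J⁰_W(A^∨(m))` agree.** [cite: Jannsen1990MixedMotives, §9 Lemma 9.2]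
[cite: Carlson1980, §2(c) Remark (3)] -/
theorem nonempty_congruence_iff_tateSubInvariant_eq {VE' : Type*} [AddCommGroup VE'] [Module ℚ VE']
    (E' : Extension A (tate m).toMixedHodgeStructure VE') :
    Nonempty (Congruence E E') ↔ E.tateSubInvariant = E'.tateSubInvariant := by
  rw [tateSubInvariant, tateSubInvariant, (Ext.tateSubEquivJacobianW A m).injective.eq_iff,
    Ext.mkOfW_eq_mkOfW_iff]

/-- **An extension of `A` by `ℚ(m)` splits iff its invariant in `J⁰_W(A^∨(m))` vanishes.**
[cite: Jannsen1990MixedMotives, §9 Lemma 9.2] -/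
theorem isSplit_iff_tateSubInvariant_eq_zero : E.IsSplit ↔ E.tateSubInvariant = 0 := by
  rw [tateSubInvariant, ← Ext.mkOfW_eq_zeroW_iff E, ← Ext.tateSubEquivJacobianW_zeroW A m,
    (Ext.tateSubEquivJacobianW A m).injective.eq_iff]

/-- Congruent extensions have the same invariant. [cite: Jannsen1990MixedMotives, §9 Lemma 9.2] -/
theorem tateSubInvariant_eq_of_congruence {VE' : Type*} [AddCommGroup VE'] [Module ℚ VE']
    {E' : Extension A (tate m).toMixedHodgeStructure VE'} (c : Congruence E E') :
    E.tateSubInvariant = E'.tateSubInvariant :=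
  (E.nonempty_congruence_iff_tateSubInvariant_eq E').1 ⟨c⟩

/-- **Additivity for the Baer sum.** [cite: Carlson1980, §2(b) Prop. 1] -/
theorem tateSubInvariant_baerSum {VE₁ VE₂ : Type*} [AddCommGroup VE₁] [Module ℚ VE₁]
    [AddCommGroup VE₂] [Module ℚ VE₂]
    (E₁ : Extension A (tate m).toMixedHodgeStructure VE₁)
    (E₂ : Extension A (tate m).toMixedHodgeStructure VE₂) :
    (baerSum E₁ E₂).tateSubInvariant = E₁.tateSubInvariant + E₂.tateSubInvariant := by
  rw [tateSubInvariant, tateSubInvariant, tateSubInvariant, Ext.mkOfW_baerSum,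
    Ext.tateSubEquivJacobianW_addW]

end Extension

/-- **Every element of `J⁰_W(A^∨(m))` is the invariant of an extension of `A` by `ℚ(m)`** (on the
carrier `VA × ℚ`). [cite: Jannsen1990MixedMotives, §9 Lemma 9.2] -/
theorem exists_tateSubInvariant_eq (y : (A.dual.tateTwist m).jacobianW) :
    ∃ E : Extension A (tate m).toMixedHodgeStructure (VA × ℚ), E.tateSubInvariant = y := by
  obtain ⟨x, hx⟩ := (Ext.tateSubEquivJacobianW A m).surjective y
  obtain ⟨E, rfl⟩ := Ext.mk_surjective x
  exact ⟨E, by rw [Extension.tateSubInvariant, Ext.mkOfW_eq_mk, hx]⟩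

/-- `W_{2m}(A^∨) = (W_{-2m-1}A)^⊥ = 0` when `W_{-2m-1}A = A` (all weights of `A` are `< -2m`, the weight
of `ℚ(m)`). [cite: DeligneHodgeII1971, 1.1.7] -/
theorem dual_W_two_mul_eq_bot (hA : A.W (-2 * m - 1) = ⊤) : A.dual.W (2 * m) = ⊥ := by
  rw [dual_W, show -(2 * m) - 1 = -2 * m - 1 by ring, hA, Submodule.dualAnnihilator_top]

variable {A m} in
/-- **An extension `0 → ℚ(m) → E → A → 0` with `A` of weights `< -2m` splits**: `J⁰_W(A^∨(m)) = 0`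
since `W_{2m}(A^∨) = (W_{-2m-1}A)^⊥ = 0` (a sub of weight above all weights of the quotient splits
off). [cite: Jannsen1990MixedMotives, §9 Lemma 9.2] -/
theorem Extension.isSplit_of_W_eq_top [FiniteDimensional ℚ VE] (hA : A.W (-2 * m - 1) = ⊤)
    (E : Extension A (tate m).toMixedHodgeStructure VE) : E.IsSplit := by
  rw [E.isSplit_iff_tateSubInvariant_eq_zero, E.tateSubInvariant_eq_evalClassW]
  exact Extension.evalClassW_eq_zero_of_isSplit
    (Extension.isSplit_of_W_eq_bot (dual_W_two_mul_eq_bot A m hA) _)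

end TateSub

end MixedHodgeStructure

end Literature.AlgebraicGeometry.Motives

end
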